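import Mathlib
import Summits.Schanuel.Schanuel.Theorems.RigidCoreMinimalCounterexampleInAclNoFullLineOfCosetLineSparsity
import Summits.Schanuel.Schanuel.Theorems.RigidCoreMinimalCounterexampleInAclLineVarietyDeadDirections
import Summits.Schanuel.Schanuel.Theorems.RigidCoreMinimalCounterexampleInAclMonomialSliceVariety

/-!
# S7b FROM K-GENERIC COSET-LINE SPARSITY — crux stmt-Schanuel-0969 `RigidCore.MinimalCounterexampleInAcl`

Line `kernel-arithmetic-selection` (lead prover-line-stmt-Schanuel-0969-c16-0), registered stub
`stub_noFullLine_of_genericSparsity` (R3♮, glue; `--supports stmt-Schanuel-0969`): the formal reduction of S7b (no full line of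
mates in a log direction at corank `≥ 2`) to the K-GENERIC DIMENSION-DROP FORM FCS♮ of coset-line sparsity (the antecedent):

* FCS♮ — a fibre-finite coset family `q : ℤ → ℂ^ι` of ℚ-linearly independent points over `c + 2πiℤ` in the coordinate `i₀` has
  upper Banach density zero as soon as, along every sub-family `J'` of positive upper Banach density and for every lattice `Λ` of
  integer directions dead (constant) along `J'`, there are constants `ev : κ → ℂ` over which all points `P_j = (q_j, e^{q_j})`,
  `j ∈ J'`, have the SAME TYPE (the ℚ-relations of `(ev, P_{j₀})` and of `(ev, P_j)` coincide) and an index set `T` of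
  coordinates with `#T + rank Λ < #ι` such that every coordinate of `P_{j₀}` is algebraic over `ℚ(ev)[P_{j₀}|_T]`.

PROOF (as the landed R3 `stub_noFullLine_of_cosetLineSparsity`, with the type data in place of the closed set).  Suppose every
kernel translate `(x_i + 2πijμ_i)_{i<r}`, `j ∈ ℤ`, is the log part of a mate `xm_j` of `x`.  Pick `μ_{k₀} = d ≠ 0`; then
`xm_j k₀ = x_{k₀} + 2πijd`, `j ↦ xm_j` is injective, and the reindexed family `q_m = xm_{m/d}` over `J = dℤ` is a coset family in
the coordinate `k₀`, ℚ-linearly independent (mates) and fibre-finite (`locusMates_cexp_fibre_finite`).  Along a positive-density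
`J'' ⊆ dℤ` (infinite, `infinite_of_upperDensity_pos`) two members differ in the coordinate `k₀`, so for a dead lattice `Λ` with
ℤ-basis `M¹, …, Mᵐ` (`Submodule.basisOfPid`) the coordinate vector `e_{k₀}` is independent of `Λ` and `m + 1 ≤ n`
(`succ_le_of_single_notMem`).  TYPE DATA (`typeData_of_deadLattice`): at the base mate `z = q_{j₀}` put `bᵗ = Mᵗ·z`,
`βᵗ = ∏ (e^{z_i})^{Mᵗ_i} = e^{bᵗ}`, `ev = (b, β)`; the ℚ-relations of `(ev, P_{j₀})` and `(ev, P_j)` coincide by the Laurent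
transfer `laurent_relations_transfer` in BOTH directions (mates of a first failure have EQUAL `locusPts`, `mate_firstFailure_voc`,
and the dead values `b`, `β` are the same at every member), and the coordinate set `T` with `#T + m + 1 ≤ n` over which, with
`b, β`, every coordinate of `P_{j₀}` is algebraic is `exists_coordFinset` (the index form of `exists_coordSet`: `SchanuelRank m` at
the ℚ-independent `b` inside `ℚ(z, e^z)` of transcendence degree `< n`), moved over `ℚ(ev)` by
`isAlgebraic_adjoin_adjoin_of_isAlgebraic_adjoin_union`.  FCS♮ then says `dℤ` has upper Banach density zero, contradicting
`not_densityZero_multiples`.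

References: status note `Cruxes/MinimalCounterexampleInAcl/Lines/kernel_arithmetic_selection.md` §Addendum c16; Kirby 2010,
Prop. 7.2.
-/

noncomputable section

set_option linter.dupNamespace false

open Complex Set

namespace Summit.Schanuel.Schanuel.Cruxes.MinimalCounterexampleInAcl.KernelArithmeticSelection

open Literature.NumberTheory.Transcendental

variable {n m : ℕ}

/-! ## The coordinate count at a first failure, index form -/

/-- **The transcendence count, index form.**  At a first failure `z` of rank `n`, for ℤ-linearly independent integer directions
`M¹, …, Mᵐ` with `m < n`, there is a finite set `T` of INDICES of coordinates of `(z, e^z)` with `#T + m + 1 ≤ n` such that every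
coordinate of `(z, e^z)` is algebraic over `ℚ[b, e^b, (z, e^z)|_T]`, `bᵗ = Mᵗ·z`, `e^{bᵗ} = ∏ (e^{z_i})^{Mᵗ_i}` (`SchanuelRank m` at the
ℚ-independent `b` inside `ℚ(z, e^z)` of transcendence degree `< n`; same proof as `exists_coordSet`, which returns the set of values).
[cite: Kirby2010, Prop. 7.2] -/
theorem exists_coordFinset {z : Fin n → ℂ} (hz : z ∈ firstFailures n) {M : Fin m → Fin n → ℤ}
    (hM : LinearIndependent ℤ M) (hmn : m < n) :
    ∃ T : Finset (Fin n ⊕ Fin n), T.card + m + 1 ≤ n ∧ ∀ v : Fin n ⊕ Fin n,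
      IsAlgebraic ↥(Algebra.adjoin ℚ (Set.range (fun t : Fin m => ∑ i, (M t i : ℂ) * z i) ∪
        Set.range (fun t : Fin m => ∏ i, cexp (z i) ^ (M t i : ℤ)) ∪
        Sum.elim z (cexp ∘ z) '' (↑T : Set (Fin n ⊕ Fin n)))) (Sum.elim z (cexp ∘ z) v) := by
  classical
  set Pt : Fin n ⊕ Fin n → ℂ := Sum.elim z (cexp ∘ z) with hPt
  set b : Fin m → ℂ := fun t => ∑ i, (M t i : ℂ) * z i with hb
  set β : Fin m → ℂ := fun t => ∏ i, cexp (z i) ^ (M t i : ℤ) with hβ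
  have hbβ : cexp ∘ b = β := funext fun t => cexp_intCombination z (M t)
  have hbli : LinearIndependent ℚ b := linearIndependent_intCombos hz.1 hM
  set F₀ : Fin m ⊕ Fin m → ℂ := Sum.elim b β with hF₀
  -- Schanuel in rank `m`
  have hSR : (m : Cardinal) ≤ Algebra.trdeg ℚ ↥(IntermediateField.adjoin ℚ (range b ∪ range (cexp ∘ b))) :=
    hz.2.2 m hmn b hbli
  obtain ⟨S₀, hS₀, hS₀alg⟩ := exists_finset_algebraicIndependent_maximal F₀
  have hcard := trdeg_adjoin_le_card F₀ S₀ hS₀alg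
  rw [hF₀, Set.Sum.elim_range, ← hbβ] at hcard
  have hmS₀ : m ≤ S₀.card := by exact_mod_cast hSR.trans hcard
  -- maximal extension by coordinates
  obtain ⟨T', hT', hT'alg⟩ := exists_finset_algebraicIndependent_sumElim (fun i : S₀ => F₀ i) Pt hS₀
  -- everything lies in `L = ℚ(z, e^z)`, of transcendence degree `< n`
  set L : IntermediateField ℚ ℂ := IntermediateField.adjoin ℚ (range z ∪ range (cexp ∘ z)) with hL
  have hzL : ∀ i, z i ∈ L := fun i => IntermediateField.subset_adjoin ℚ _ (Or.inl ⟨i, rfl⟩)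
  have hezL : ∀ i, cexp (z i) ∈ L := fun i => IntermediateField.subset_adjoin ℚ _ (Or.inr ⟨i, rfl⟩)
  have hmemL : ∀ k, Sum.elim (fun i : S₀ => F₀ i) (fun i : T' => Pt i) k ∈ L := by
    rintro (⟨a, ha⟩ | ⟨v, hv⟩)
    · rcases a with t | t
      · show ∑ i, (M t i : ℂ) * z i ∈ L
        exact sum_mem fun i _ => mul_mem (intCast_mem L _) (hzL i)
      · show ∏ i, cexp (z i) ^ (M t i : ℤ) ∈ L
        exact prod_mem fun i _ => zpow_mem (hezL i) _
    · rcases v with i | i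
      · exact hzL i
      · exact hezL i
  let w : S₀ ⊕ T' → L := fun k => ⟨_, hmemL k⟩
  have hw : AlgebraicIndependent ℚ w := AlgebraicIndependent.of_comp L.val hT'
  have hle := hw.cardinalMk_le_trdeg
  simp only [Cardinal.mk_fintype, Fintype.card_sum, Fintype.card_coe] at hle
  have h1 : ((S₀.card + T'.card : ℕ) : Cardinal) ≤ Algebra.trdeg ℚ L := by exact_mod_cast hle
  have h2 : Algebra.trdeg ℚ L < (n : Cardinal) := hz.2.1
  have hlt : S₀.card + T'.card < n := by exact_mod_cast h1.trans_lt h2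
  refine ⟨T', by omega, fun v => (hT'alg v).tower_top_of_subalgebra_le (Algebra.adjoin_mono ?_)⟩
  rintro _ ⟨k, rfl⟩
  rcases k with ⟨a, ha⟩ | ⟨v, hv⟩
  · rcases a with t | t
    · exact Or.inl (Or.inl ⟨t, rfl⟩)
    · exact Or.inl (Or.inr ⟨t, rfl⟩)
  · exact Or.inr ⟨v, Finset.mem_coe.2 hv, rfl⟩

/-! ## The type data of a dead lattice along a family of mates -/

/-- **TYPE DATA OF A DEAD LATTICE.**  Let `x` be a first failure of rank `n`, `q : ℤ → ℂⁿ` a family of mates of `x` over `J`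
two of whose members differ in some coordinate, and `Λ ≤ ℤⁿ` a lattice of directions dead along the family.  Then with the
constants `ev = (b, β)`, `bᵗ = Mᵗ·q_{j₀}`, `βᵗ = ∏ (e^{q_{j₀} i})^{Mᵗ_i}` (`M` a ℤ-basis of `Λ`, `j₀ ∈ J`), all points
`P_j = (q_j, e^{q_j})`, `j ∈ J`, have the same type over `ℚ(ev)` (`laurent_relations_transfer` both ways: mates have equal
`locusPts` and equal dead values), and some index set `T` of coordinates with `#T + rank Λ < n` makes every coordinate of `P_{j₀}`
algebraic over `ℚ(ev)[P_{j₀}|_T]` (`exists_coordFinset`; the rank bound `rank Λ + 1 ≤ n` because the moving coordinate is not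
dead, `succ_le_of_single_notMem`). [cite: Kirby2010, Prop. 7.2] -/
theorem typeData_of_deadLattice {x : Fin n → ℂ} (hx : x ∈ firstFailures n) {J : Set ℤ} {q : ℤ → Fin n → ℂ}
    (hmates : ∀ j ∈ J, q j ∈ locusMates x) {j₁ j₂ : ℤ} (hj₁ : j₁ ∈ J) (hj₂ : j₂ ∈ J) {i₁ : Fin n}
    (hne : q j₁ i₁ ≠ q j₂ i₁) (Λ : Submodule ℤ (Fin n → ℤ))
    (hdead : ∀ M ∈ Λ, ∀ j ∈ J, ∀ j' ∈ J, (∑ i, (M i : ℂ) * q j i) = ∑ i, (M i : ℂ) * q j' i) :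
    ∃ (κ : Type) (ev : κ → ℂ) (j₀ : ℤ) (T : Finset (Fin n ⊕ Fin n)), j₀ ∈ J ∧
      (∀ j ∈ J, ∀ H : MvPolynomial (κ ⊕ (Fin n ⊕ Fin n)) ℚ,
        MvPolynomial.aeval (Sum.elim ev (Sum.elim (q j₀) (Complex.exp ∘ q j₀))) H = 0 ↔
          MvPolynomial.aeval (Sum.elim ev (Sum.elim (q j) (Complex.exp ∘ q j))) H = 0) ∧
      (∀ v : Fin n ⊕ Fin n, IsAlgebraic ↥(Algebra.adjoin ↥(IntermediateField.adjoin ℚ (Set.range ev))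
        ((Sum.elim (q j₀) (Complex.exp ∘ q j₀)) '' (↑T : Set (Fin n ⊕ Fin n)))) (Sum.elim (q j₀) (Complex.exp ∘ q j₀) v)) ∧
      T.card + Module.finrank ℤ ↥Λ < Fintype.card (Fin n) := by
  classical
  -- a ℤ-basis of `Λ`
  obtain ⟨m, bΛ⟩ := Submodule.basisOfPid (Pi.basisFun ℤ (Fin n)) Λ
  have hfin : Module.finrank ℤ Λ = m := by
    rw [Module.finrank_eq_card_basis bΛ, Fintype.card_fin]
  set M : Fin m → Fin n → ℤ := fun t => ((bΛ t : Λ) : Fin n → ℤ) with hMdef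
  have hMmem : ∀ t, M t ∈ Λ := fun t => (bΛ t).2
  have hM : LinearIndependent ℤ M := bΛ.linearIndependent.map' Λ.subtype (Submodule.ker_subtype Λ)
  -- the rank bound: the moving coordinate `i₁` is not dead
  have hmn : m + 1 ≤ n := by
    refine succ_le_of_single_notMem bΛ i₁ fun c hc => ?_
    by_contra hc0
    have h := hdead _ hc j₁ hj₁ j₂ hj₂
    rw [sum_smul_single_mul, sum_smul_single_mul] at h
    exact hne (mul_left_cancel₀ (Int.cast_ne_zero.2 hc0) h)
  -- the base mate `q j₁` is a first failure
  obtain ⟨hff₁, -⟩ := mate_firstFailure_voc hx (hmates j₁ hj₁)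
  -- the family of points `P j = (q j, e^{q j})`; the hypotheses of the Laurent transfer between ANY two members
  let P : ℤ → Fin n ⊕ Fin n → ℂ := fun j => Sum.elim (q j) (cexp ∘ q j)
  have hnz : ∀ j ∈ J, ∀ i : Fin n, P j (Sum.inr i) ≠ 0 := fun j _ i => Complex.exp_ne_zero _
  have hrelAll : ∀ j ∈ J, ∀ j' ∈ J, ∀ G : MvPolynomial (Fin n ⊕ Fin n) ℚ,
      MvPolynomial.aeval (P j) G = 0 → MvPolynomial.aeval (P j') G = 0 := by
    intro j hj j' hj' G hG
    obtain ⟨-, hlocus⟩ := mate_firstFailure_voc hx (hmates j hj)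
    have hjl : q j' ∈ locusPts (q j) := by
      rw [hlocus]
      exact (hmates j' hj').2
    exact hjl G hG
  have haddAll : ∀ t : Fin m, ∀ j ∈ J, ∀ j' ∈ J,
      (∑ i, (M t i : ℂ) * P j (Sum.inl i)) = ∑ i, (M t i : ℂ) * P j' (Sum.inl i) :=
    fun t j hj j' hj' => hdead _ (hMmem t) j hj j' hj'
  have hmulAll : ∀ t : Fin m, ∀ j ∈ J, ∀ j' ∈ J,
      (∏ i, P j (Sum.inr i) ^ (M t i : ℤ)) = ∏ i, P j' (Sum.inr i) ^ (M t i : ℤ) := by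
    intro t j hj j' hj'
    show (∏ i, cexp (q j i) ^ (M t i : ℤ)) = ∏ i, cexp (q j' i) ^ (M t i : ℤ)
    rw [← cexp_intCombination, ← cexp_intCombination, hdead _ (hMmem t) j hj j' hj']
  -- the dead constants `ev = (b, β)` at the base mate
  let b : Fin m → ℂ := fun t => ∑ i, (M t i : ℂ) * P j₁ (Sum.inl i)
  let β : Fin m → ℂ := fun t => ∏ i, P j₁ (Sum.inr i) ^ (M t i : ℤ)
  let ev : Fin m ⊕ Fin m → ℂ := Sum.elim b β
  -- the coordinate set
  obtain ⟨T, hTcard, hTalg⟩ := exists_coordFinset hff₁ hM (by omega)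
  refine ⟨Fin m ⊕ Fin m, ev, j₁, T, hj₁, fun j hj H => ⟨fun hH => ?_, fun hH => ?_⟩, fun v => ?_, ?_⟩
  · -- relations of `(ev, P j₁)` hold at `(ev, P j)`
    exact laurent_relations_transfer M J P j₁ hj₁ hnz (fun j' hj' G hG => hrelAll j₁ hj₁ j' hj' G hG)
      (fun t j' hj' => haddAll t j' hj' j₁ hj₁) (fun t j' hj' => hmulAll t j' hj' j₁ hj₁) hj H hH
  · -- relations of `(ev, P j)` hold at `(ev, P j₁)`: transfer based at `j`, whose constants are the same dead values
    have hb : (fun t => ∑ i, (M t i : ℂ) * P j (Sum.inl i)) = b := funext fun t => haddAll t j hj j₁ hj₁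
    have hβ : (fun t => ∏ i, P j (Sum.inr i) ^ (M t i : ℤ)) = β := funext fun t => hmulAll t j hj j₁ hj₁
    have h := laurent_relations_transfer M J P j hj hnz (fun j' hj' G hG => hrelAll j hj j' hj' G hG)
      (fun t j' hj' => haddAll t j' hj' j hj) (fun t j' hj' => hmulAll t j' hj' j hj) hj₁ H
    rw [hb, hβ] at h
    exact h hH
  · -- algebraicity over `ℚ(ev)[P j₁|_T]`
    have hev : Set.range ev = Set.range b ∪ Set.range β := Set.Sum.elim_range _ _
    refine isAlgebraic_adjoin_adjoin_of_isAlgebraic_adjoin_union ev ?_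
    rw [hev]
    exact hTalg v
  · -- the count
    rw [hfin, Fintype.card_fin]
    omega

/-! ## The registered stub -/

/-- **Stub R3♮ — S7b FROM K-GENERIC COSET-LINE SPARSITY (glue; PROVED).**  FCS♮ ⟹ S7b: a full line of mates `j ↦ xm_j` in the
log direction `μ` (`μ_{k₀} = d ≠ 0`) is, after reindexing `m = jd`, a coset family over `dℤ` in the coordinate `k₀`
(`xm_j k₀ = x_{k₀} + 2πijd`), ℚ-linearly independent (mates), fibre-finite (`locusMates_cexp_fibre_finite`); along every
positive-density sub-family (infinite, so two members differ in the coordinate `k₀`) and for every dead lattice the type data are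
`typeData_of_deadLattice`; FCS♮ then gives upper Banach density zero for `dℤ`, which has density `1/|d|`
(`not_densityZero_multiples`). [cite: Kirby2010, Prop. 7.2] -/
theorem stub_noFullLine_of_genericSparsity : (∀ (ι : Type) [Fintype ι] (i₀ : ι) (c : ℂ) (J : Set ℤ) (q : ℤ → ι → ℂ), (∀ j ∈ J, LinearIndependent ℚ (q j) ∧ q j i₀ = c + 2 * ↑Real.pi * Complex.I * (j : ℂ)) → (∀ ω : ι → ℂ, Set.Finite {j : ℤ | j ∈ J ∧ Complex.exp ∘ q j = ω}) → (∀ J' ⊆ J, (∃ δ : ℝ, 0 < δ ∧ ∀ N₀ : ℕ, ∃ N : ℕ, N₀ ≤ N ∧ ∃ a : ℤ, δ * (N : ℝ) ≤ (Set.ncard {j : ℤ | j ∈ Finset.Ico a (a + (N : ℤ)) ∧ j ∈ J'} : ℝ)) → ∀ Λ : Submodule ℤ (ι → ℤ), (∀ M ∈ Λ, ∀ j ∈ J', ∀ j' ∈ J', (∑ i, (M i : ℂ) * q j i) = ∑ i, (M i : ℂ) * q j' i) → ∃ (κ : Type) (ev : κ → ℂ) (j₀ : ℤ) (T : Finset (ι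 ⊕ ι)), j₀ ∈ J' ∧ (∀ j ∈ J', ∀ H : MvPolynomial (κ ⊕ (ι ⊕ ι)) ℚ, MvPolynomial.aeval (Sum.elim ev (Sum.elim (q j₀) (Complex.exp ∘ q j₀))) H = 0 ↔ MvPolynomial.aeval (Sum.elim ev (Sum.elim (q j) (Complex.exp ∘ q j))) H = 0) ∧ (∀ v : ι ⊕ ι, IsAlgebraic ↥(Algebra.adjoin ↥(IntermediateField.adjoin ℚ (Set.range ev)) ((Sum.elim (q j₀) (Complex.exp ∘ q j₀)) '' (↑T : Set (ι ⊕ ι)))) (Sum.elim (q j₀) (Complex.exp ∘ q j₀) v)) ∧ T.card + Module.finrank ℤ ↥Λ < Fintype.card ι) → ∀ δ : ℝ, 0 < δ → ∃ N₀ : ℕ, ∀ N : ℕ, N₀ ≤ N → ∀ a : ℤ, (Set.ncard {j : ℤ | j ∈ Finset.Ico a (a + (N : ℤ)) ∧ j ∈ J} : ℝ) < δ * (N : ℝ)) → ∀ (n r : ℕ), 3 ≤ n → r + 2 ≤ n → ∀ (x : Fin n → ℂ), x ∈ Summit.Schanuel.Schanuel.Cruxes.MinimalCounterexampleInAcl.KernelArithmeticSelection.firstFailures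 n → (∀ i : Fin n, (i : ℕ) < r → IsAlgebraic ℚ (Complex.exp (x i))) → (∀ M : Fin n → ℤ, (∃ i : Fin n, r ≤ (i : ℕ) ∧ M i ≠ 0) → Transcendental ℚ (Complex.exp (∑ i, (M i : ℂ) * x i))) → ∀ μ : Fin n → ℤ, (∀ i : Fin n, r ≤ (i : ℕ) → μ i = 0) → μ ≠ 0 → ∃ j : ℤ, ¬ ∃ x' ∈ Summit.Schanuel.Schanuel.Cruxes.MinimalCounterexampleInAcl.KernelArithmeticSelection.locusMates x, ∀ i : Fin n, (i : ℕ) < r → x' i = x i + 2 * ↑Real.pi * Complex.I * ((j • μ) i : ℂ) := by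
  intro hGen n r _ _ x hx _ _ μ hμsupp hμ
  classical
  by_contra hall
  push Not at hall
  choose xm hxm hxmeq using hall
  obtain ⟨k₀, hk₀⟩ : ∃ k₀, μ k₀ ≠ 0 := Function.ne_iff.1 hμ
  set d : ℤ := μ k₀ with hd
  have hd0 : d ≠ 0 := hk₀
  have hk₀r : (k₀ : ℕ) < r := by
    by_contra h
    exact hk₀ (hμsupp k₀ (not_lt.1 h))
  have h2πi : (2 * ↑Real.pi * I : ℂ) ≠ 0 := by simp [Real.pi_ne_zero, I_ne_zero]
  -- ### the moving coordinate of the mates on the line; injectivity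
  have hxmk : ∀ j : ℤ, xm j k₀ = x k₀ + 2 * ↑Real.pi * I * ((j * d : ℤ) : ℂ) := by
    intro j
    rw [hxmeq j k₀ hk₀r, Pi.smul_apply, smul_eq_mul]
  have hxminj : Function.Injective xm := by
    intro j j' hjj
    have h := congrFun hjj k₀
    rw [hxmk, hxmk, add_right_inj] at h
    have h' : ((j * d : ℤ) : ℂ) = ((j' * d : ℤ) : ℂ) := mul_left_cancel₀ h2πi h
    have h'' : j * d = j' * d := by exact_mod_cast h'
    exact mul_right_cancel₀ hd0 h''
  -- ### the reindexed coset family `q_m = xm_{m/d}` over `dℤ`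
  set q : ℤ → Fin n → ℂ := fun m => xm (m / d) with hq
  have hpts : ∀ m ∈ {m : ℤ | d ∣ m}, LinearIndependent ℚ (q m) ∧ q m k₀ = x k₀ + 2 * ↑Real.pi * I * (m : ℂ) := by
    intro m hm
    refine ⟨(hxm (m / d)).1, ?_⟩
    show xm (m / d) k₀ = _
    rw [hxmk, Int.ediv_mul_cancel hm]
  refine not_densityZero_multiples hd0 (hGen (Fin n) k₀ (x k₀) {m : ℤ | d ∣ m} q hpts ?_ ?_)
  · -- every exponential fibre is met finitely
    intro ω
    refine (((locusMates_cexp_fibre_finite hx ω).preimage hxminj.injOn).image (fun j : ℤ => j * d)).subset ?_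
    rintro m ⟨hm, hω⟩
    exact ⟨m / d, ⟨hxm _, hω⟩, Int.ediv_mul_cancel hm⟩
  · -- the type data along positive-density sub-families
    rintro J'' hJ''sub ⟨δ, hδ, hdens⟩ Λ hdead
    have hJ''inf : J''.Infinite := infinite_of_upperDensity_pos hδ hdens
    obtain ⟨m₁, hm₁, m₂, hm₂, hne⟩ := hJ''inf.nontrivial
    have hne' : q m₁ k₀ ≠ q m₂ k₀ := by
      rw [(hpts m₁ (hJ''sub hm₁)).2, (hpts m₂ (hJ''sub hm₂)).2]
      intro h
      rw [add_right_inj] at h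
      exact hne (by exact_mod_cast mul_left_cancel₀ h2πi h)
    exact typeData_of_deadLattice hx (fun m _ => hxm (m / d)) hm₁ hm₂ hne' Λ hdead

end Summit.Schanuel.Schanuel.Cruxes.MinimalCounterexampleInAcl.KernelArithmeticSelection

end
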